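import Summits.Ventures.PercRepro.ForceSet

/-!
# The class-level PAIR certificate for Lemma 5 with arbitrary partner classes (p6, gen 6)

`ForceSet.lean` proves Lemma 5 (`Q⁺(Δ_g, Δ_g) ≤ 0`) from a family of «split repairs» whose partners
are DIAGONAL nested classes `(J, J)`. At the full class level (`S = E ∖ {g}`) every diagonal class has
nested sum `0` (a fully forced merge vector is a single cover move), so that certificate is empty there.
This file is the same three-term AM-GM with ARBITRARY partner classes `P₁ C`, `P₂ C`: what the AM-GM
needs is only the weight identity `w(P₁ C) · w(P₂ C) = w(C)²` (`hw`), which holds for every pair of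
classes whose profiles `(1_I + 1_U)` average to the profile of `C` — for instance the two «copies»
obtained from the bad pair `(ρ, ρ′)` by duplicating `ρ` on a set `Y` of differing edges in one partner
and `ρ′` on `Y` in the other.  Each paying class may be shared between several negative classes
(`sh`, total `≤ 1`).

* `deltaQuad_nonpos_of_pairs` — the certificate;
* `patWeight_pair_of_profile` — the weight identity from the profile identity (one `Finset` identity
  per edge, `decide`-able on literals).
-/

namespace PercRepro

open Finset

namespace MultiGraph

variable {V E : Type*} [DecidableEq E] [Fintype E] (G : MultiGraph V E)

/-- **Lemma 5 from a family of PAIR repairs with sharing**: `neg` = the positive nested classes,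
each with two partner classes `P₁ C, P₂ C` in the paying set `pay`, the weight identity
`w(P₁ C) w(P₂ C) = w(C)²` (`hw`), shares `sh C IU ≥ 0` of the paying classes with total `≤ 1`,
the discriminant of each negative class against its shares of the two partners, and every class
outside `neg ∪ pay` nonpositive. Then the slack is `≤ 0`. -/
theorem deltaQuad_nonpos_of_pairs {p : E → ℝ} (hp : IsProb p) {S : Finset E} {g : E} (hg : g ∉ S)
    (a b c d : V) (neg pay : Finset (Finset E × Finset E))
    (hneg : neg ⊆ S.powerset ×ˢ S.powerset) (hpay : pay ⊆ S.powerset ×ˢ S.powerset)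
    (hdisj : Disjoint neg pay)
    (P₁ P₂ : Finset E × Finset E → Finset E × Finset E)
    (sh : Finset E × Finset E → Finset E × Finset E → ℝ)
    (hP : ∀ C ∈ neg, P₁ C ∈ pay ∧ P₂ C ∈ pay ∧ P₁ C ≠ P₂ C)
    (hw : ∀ C ∈ neg, (patWeight p S (P₁ C).1 * patWeight p S (P₁ C).2) *
      (patWeight p S (P₂ C).1 * patWeight p S (P₂ C).2) =
        (patWeight p S C.1 * patWeight p S C.2) ^ 2)
    (hsh : ∀ C IU, 0 ≤ sh C IU)
    (htot : ∀ IU ∈ pay, ∑ C ∈ neg, sh C IU ≤ 1)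
    (hpayneg : ∀ IU ∈ pay, G.nestedSum p S g a b c d IU.1 IU.2 ≤ 0)
    (hdisc : ∀ C ∈ neg, (G.nestedSum p S g a b c d C.1 C.2) ^ 2 ≤
      4 * (sh C (P₁ C) * G.nestedSum p S g a b c d (P₁ C).1 (P₁ C).2) *
        (sh C (P₂ C) * G.nestedSum p S g a b c d (P₂ C).1 (P₂ C).2))
    (hothers : ∀ IU ∈ S.powerset ×ˢ S.powerset, IU ∉ neg → IU ∉ pay →
      G.nestedSum p S g a b c d IU.1 IU.2 ≤ 0) :
    G.deltaQuad p g a b c d ≤ 0 := by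
  rw [G.deltaQuad_eq_sum_nested p hg]
  set P := S.powerset ×ˢ S.powerset with hP'
  set f : Finset E × Finset E → ℝ := fun IU =>
    patWeight p S IU.1 * patWeight p S IU.2 * G.nestedSum p S g a b c d IU.1 IU.2 with hf
  have hwt : ∀ IU : Finset E × Finset E, 0 ≤ patWeight p S IU.1 * patWeight p S IU.2 :=
    fun IU => mul_nonneg (patWeight_nonneg hp _ _) (patWeight_nonneg hp _ _)
  have hsub : neg ∪ pay ⊆ P := Finset.union_subset hneg hpay
  rw [← Finset.sum_sdiff hsub, Finset.sum_union hdisj]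
  -- the rest is ≤ 0
  have hrest : ∑ IU ∈ P \ (neg ∪ pay), f IU ≤ 0 := by
    refine Finset.sum_nonpos fun IU hIU => ?_
    have h1 := Finset.mem_sdiff.mp hIU
    have hn : IU ∉ neg := fun h => h1.2 (Finset.mem_union_left _ h)
    have hp' : IU ∉ pay := fun h => h1.2 (Finset.mem_union_right _ h)
    exact mul_nonpos_of_nonneg_of_nonpos (hwt IU) (hothers IU h1.1 hn hp')
  -- the paying classes: shares to the negative classes and a leftover
  have hpaysum : ∑ IU ∈ pay, f IU =
      ∑ IU ∈ pay, (1 - ∑ C ∈ neg, sh C IU) * f IU + ∑ C ∈ neg, ∑ IU ∈ pay, sh C IU * f IU := by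
    rw [Finset.sum_comm (s := neg), ← Finset.sum_add_distrib]
    refine Finset.sum_congr rfl fun IU _ => ?_
    rw [← Finset.sum_mul]
    ring
  have hleft : ∑ IU ∈ pay, (1 - ∑ C ∈ neg, sh C IU) * f IU ≤ 0 := by
    refine Finset.sum_nonpos fun IU hIU => ?_
    refine mul_nonpos_of_nonneg_of_nonpos (by linarith [htot IU hIU]) ?_
    exact mul_nonpos_of_nonneg_of_nonpos (hwt _) (hpayneg _ hIU)
  -- each negative class with its shares of its two partners is ≤ 0 (three-term AM-GM)
  have hnegsum : ∑ C ∈ neg, f C + ∑ C ∈ neg, ∑ IU ∈ pay, sh C IU * f IU ≤ 0 := by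
    rw [← Finset.sum_add_distrib]
    refine Finset.sum_nonpos fun C hC => ?_
    obtain ⟨hm₁, hm₂, hne⟩ := hP C hC
    have hother : ∑ IU ∈ (pay.erase (P₁ C)).erase (P₂ C), sh C IU * f IU ≤ 0 := by
      refine Finset.sum_nonpos fun IU hIU => ?_
      have hm := (Finset.mem_erase.mp (Finset.mem_erase.mp hIU).2).2
      exact mul_nonpos_of_nonneg_of_nonpos (hsh C _)
        (mul_nonpos_of_nonneg_of_nonpos (hwt _) (hpayneg _ hm))
    rw [← Finset.add_sum_erase _ _ hm₁,
      ← Finset.add_sum_erase _ _ (Finset.mem_erase.mpr ⟨hne.symm, hm₂⟩)]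
    have hamgm := amgm_triple (w := patWeight p S C.1 * patWeight p S C.2)
      (w₁ := patWeight p S (P₁ C).1 * patWeight p S (P₁ C).2)
      (w₂ := patWeight p S (P₂ C).1 * patWeight p S (P₂ C).2)
      (N := G.nestedSum p S g a b c d C.1 C.2)
      (N₁ := sh C (P₁ C) * G.nestedSum p S g a b c d (P₁ C).1 (P₁ C).2)
      (N₂ := sh C (P₂ C) * G.nestedSum p S g a b c d (P₂ C).1 (P₂ C).2)
      (hwt _) (hwt _) (hw C hC)
      (mul_nonpos_of_nonneg_of_nonpos (hsh _ _) (hpayneg _ hm₁))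
      (mul_nonpos_of_nonneg_of_nonpos (hsh _ _) (hpayneg _ hm₂))
      (hdisc C hC)
    have e0 : f C = patWeight p S C.1 * patWeight p S C.2 * G.nestedSum p S g a b c d C.1 C.2 := rfl
    have e1 : sh C (P₁ C) * f (P₁ C) =
        (patWeight p S (P₁ C).1 * patWeight p S (P₁ C).2) *
          (sh C (P₁ C) * G.nestedSum p S g a b c d (P₁ C).1 (P₁ C).2) := by
      simp only [hf]; ring
    have e2 : sh C (P₂ C) * f (P₂ C) =
        (patWeight p S (P₂ C).1 * patWeight p S (P₂ C).2) *
          (sh C (P₂ C) * G.nestedSum p S g a b c d (P₂ C).1 (P₂ C).2) := by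
      simp only [hf]; ring
    linarith [hamgm, hother, e0, e1, e2]
  linarith [hrest, hpaysum, hleft, hnegsum]

/-- A nested class with `I ⊄ U` is empty. -/
theorem nestedSum_eq_zero_of_not_subset (p : E → ℝ) (S : Finset E) (g : E) (a b c d : V)
    {I U : Finset E} (h : ¬ I ⊆ U) : G.nestedSum p S g a b c d I U = 0 := by
  unfold nestedSum
  refine Finset.sum_eq_zero fun AA hAA => ?_
  exfalso
  have h' := (Finset.mem_filter.mp hAA).2
  simp only [Prod.mk.injEq] at h'
  apply h
  rw [← h'.1, ← h'.2]
  exact Finset.inter_subset_left.trans Finset.subset_union_left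

end MultiGraph

/-- **The weight identity from the profile identity**: if on every edge of `S` the four partner
sets contain `e` exactly twice as often as the two sets of `C`, then `w(P₁) w(P₂) = w(C)²`. -/
theorem patWeight_pair_of_profile {E : Type*} [DecidableEq E] (p : E → ℝ) (S : Finset E)
    {I U I₁ U₁ I₂ U₂ : Finset E}
    (h : ∀ e ∈ S, ((if e ∈ I₁ then 1 else 0) + (if e ∈ U₁ then 1 else 0) +
      (if e ∈ I₂ then 1 else 0) + (if e ∈ U₂ then 1 else 0) : ℕ) =
        2 * ((if e ∈ I then 1 else 0) + (if e ∈ U then 1 else 0))) :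
    (patWeight p S I₁ * patWeight p S U₁) * (patWeight p S I₂ * patWeight p S U₂) =
      (patWeight p S I * patWeight p S U) ^ 2 := by
  unfold patWeight
  rw [← Finset.prod_mul_distrib, ← Finset.prod_mul_distrib, ← Finset.prod_mul_distrib,
    ← Finset.prod_mul_distrib, ← Finset.prod_pow]
  refine Finset.prod_congr rfl fun e he => ?_
  have he' := h e he
  split_ifs at he' ⊢ <;> simp only [add_zero, zero_add, mul_zero, mul_one] at he' <;>
    first | omega | ring

end PercRepro
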